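import Mathlib
import HarnessLib
import Summits.NavierStokesRegularity.NavierStokesRegularity.Theorems.HalfSpaceWindowDoorCirculationCarryingRigidityEddyLiouville

/-!
# Route `HalfSpaceWindowDoor`, crux `CirculationCarryingRigidity` (stmt-NavierStokesRegularity-25311) —
# line `eddy_covariance`: DEAD STRATA of the eddy bound and the residue as an EDDY-LIFT (covariance) statement

LEAD ns-hsw-p1 g10, `--supports stmt-NavierStokesRegularity-25311 --as helper`; card `Cruxes/…/Lines/eddy_covariance.md`.
Consequences of `…EddyLiouville.inner_curl_e3_eq_zero_of_eddyBound` (W6 ⟸ `ℛ ≤ (B/√(−t))(∮ω₃ dl + |∮ω_r dl|)` on record far circles,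
time-only class, any `C`).  The eddy remainder splits as `ℛ = E − ∮(v_r − v̄_r)ω₃ dl` with the EDDY LIFT
`E(r,z,t) = ∮_{S(r,z)} (v_z − v̄_z) ω_r dl` (the circle covariance of vertical velocity and radial vorticity, times `2πr`), and
`−∮(v_r − v̄_r)ω₃ dl ≤ (2C/√(−t))∮ω₃ dl` is free in the class (`remainder_le_eddyLift_add`).  Hence:

* `inner_curl_e3_eq_zero_of_eddyLiftBound` — W6 ⟸ the EDDY-LIFT bound `E ≤ (B/√(−t))(∮ω₃ dl + |∮ω_r dl|)` on record far circles
  about one axis in one far-past epoch (the sharpest residue of the census so far: g9's radial lift `∮ω_r v_z dl` minus its mean part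
  `v̄_z ∮ω_r dl = −v̄_z Γ_z`, which is now free);
* `inner_curl_e3_eq_zero_of_radial_noncancel` — STRATUM «non-cancelling radial vorticity»: if on the far circles of one epoch
  `∮|ω_r| dl ≤ K(∮ω₃ dl + |∮ω_r dl|)` (the radial vorticity around the circle is dominated by its NET amount plus the vertical
  vorticity), the profile is poloidal (`|E| ≤ (2C/√(−t))∮|ω_r| dl`); contains g9's radial cone `∮|ω_r| dl ≤ K∮ω₃ dl` and
* `inner_curl_e3_eq_zero_of_radial_oneSigned` — STRATUM «one-signed radial vorticity»: `ω_r ≥ 0` on each far circle, or `≤ 0` on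
  each (the sign may vary from circle to circle) ⇒ poloidal;
* `inner_curl_e3_eq_zero_of_axisymmetric_vz` — STRATUM «axisymmetric vertical velocity in the far field»: `v_z` constant on each far
  circle of one epoch ⇒ poloidal (`E = 0`), whatever `v_r, v_θ, ω` do;
* `enemy_radial_cancelling` — ENEMY READING: a circulation-carrying closed-hemisphere profile has, for every `K, R₀` and every far-past
  epoch, a record far circle with `∮|ω_r| dl > K(∮ω₃ dl + |∮ω_r dl|)`: its radial vorticity there is SIGN-CHANGING around the circle
  (vortex lines weaving in AND out of the cylinder wall, net flux comparatively negligible) and dominates the vertical vorticity — and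
  (`…EddyLiouville.enemy_eddy_fails`) it is positively correlated with the vertical-velocity fluctuation.
WHAT THIS IS NOT: not about NS regularity (Clay A); HYPOTHETICAL blow-up profiles (KNSS ancient mild solutions); the item stays OPEN
at its research stub `stub_layerExclusion ≡ HemisphereLiouvilleE3`; no item is closed by this file.
-/

noncomputable section

-- the summit and its single sub-problem share the name (CONVENTIONS §1), as in every Theorems file
set_option linter.dupNamespace false

namespace Summit.NavierStokesRegularity.NavierStokesRegularity.Theorems.HalfSpaceWindowDoorCirculationCarryingRigidityEddyStrata

open MeasureTheory Set Function Filter Topology InnerProductSpace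
open scoped RealInnerProductSpace InnerProductSpace
open Literature.Analysis Literature.Analysis.UnboundedOperators
open Literature.Analysis.FluidPDE hiding eR
open Summit.NavierStokesRegularity.NavierStokesRegularity.Theorems.HalfSpaceWindowDoorCirculationCarryingRigidityDefs
  (InDoorClass SignE3 e3 HemisphereLiouvilleE3)
open Summit.NavierStokesRegularity.NavierStokesRegularity.Theorems.AxisTwistDoorAveragedConeLiouvilleDefs
  (cylPt eT eR circ vortCirc radVortCirc circleTerm meanR meanZ remainder)
open Summit.NavierStokesRegularity.NavierStokesRegularity.Theorems.AveragedConeLiouville.CircleStokes (continuous_eR)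
open Summit.NavierStokesRegularity.NavierStokesRegularity.Theorems.AxisTwistDoorAveragedConeLiouvilleCylFrame
  (continuous_cylPt_θ abs_inner_eR_le abs_inner_e3_le)
open Summit.NavierStokesRegularity.NavierStokesRegularity.Theorems.AveragedConeLiouville.CircMonotone (vortCirc_nonneg)
open Summit.NavierStokesRegularity.NavierStokesRegularity.Theorems.HalfSpaceWindowDoorCirculationCarryingRigidityConeFluxSubsolution
  (signE3_atd contDiff_one_slice)
open Summit.NavierStokesRegularity.NavierStokesRegularity.Theorems.HalfSpaceWindowDoorCirculationCarryingRigidityEddyMeans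
  (abs_meanR_le abs_meanZ_le)
open Summit.NavierStokesRegularity.NavierStokesRegularity.Theorems.HalfSpaceWindowDoorCirculationCarryingRigidityEddyLiouville
  (inner_curl_e3_eq_zero_of_eddyBound)

variable {C : ℝ} {v : ℝ → EuclideanSpace ℝ (Fin 3) → EuclideanSpace ℝ (Fin 3)}

-- AxisTwistDoor's `e₃` (the same vector `EuclideanSpace.single 2 1` as the route's `Defs.e3`) is opened under the name `e3A`
open Summit.NavierStokesRegularity.NavierStokesRegularity.Theorems.AxisTwistDoorAveragedConeLiouvilleDefs renaming e3 → e3A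

/-! ### Continuity of the circle integrands -/

/-- The slice along the circle `θ ↦ v(s)(cylPt r θ z)` is continuous. -/
theorem continuous_v_circle (hv : InDoorClass C v) {s : ℝ} (hs : s < 0) (r z : ℝ) :
    Continuous fun θ => v s (cylPt r θ z) :=
  (contDiff_one_slice hv hs).continuous.comp (continuous_cylPt_θ r z)

/-- The vorticity along the circle `θ ↦ curl v(s)(cylPt r θ z)` is continuous. -/
theorem continuous_curl_circle (hv : InDoorClass C v) {s : ℝ} (hs : s < 0) (r z : ℝ) :
    Continuous fun θ => curl (v s) (cylPt r θ z) := by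
  have hv1 := contDiff_one_slice hv hs
  have hD : Continuous (fderiv ℝ (v s)) := hv1.continuous_fderiv one_ne_zero
  have e : curl (v s) = fun x => curlCLM (fderiv ℝ (v s) x) := by funext x; exact curl_eq_curlCLM (v s) x
  rw [e]
  exact (curlCLM.continuous.comp hD).comp (continuous_cylPt_θ r z)

/-! ### The split `ℛ = E − ∮(v_r − v̄_r)ω₃ dl` and the free bound on the second part -/

/-- **`ℛ ≤ E + (2C/√(−s))∮ω₃ dl`**: the eddy remainder is the eddy lift `E = ∮(v_z − v̄_z)ω_r dl` minus `∮(v_r − v̄_r)ω₃ dl`, and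
`|v_r − v̄_r| ≤ 2C/√(−s)`, `ω₃ ≥ 0`. -/
theorem remainder_le_eddyLift_add (hv : InDoorClass C v) (hsign : SignE3 v) {s : ℝ} (hs : s < 0) {r : ℝ} (hr : 0 ≤ r) (z : ℝ) :
    remainder v r z s ≤
      (∫ θ in (0 : ℝ)..(2 * Real.pi), (⟪v s (cylPt r θ z), e3A⟫ - meanZ v r z s) * ⟪curl (v s) (cylPt r θ z), eR θ⟫ * r) +
        2 * C / Real.sqrt (-s) * vortCirc v r z s := by
  have hsq : 0 < Real.sqrt (-s) := Real.sqrt_pos.2 (neg_pos.2 hs)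
  have hC : 0 ≤ C := HalfSpaceWindowDoorCirculationCarryingRigidityConeFluxSubsolution.typeI_const_nonneg hv
  have hvc := continuous_v_circle hv hs r z
  have hωc := continuous_curl_circle hv hs r z
  have hmR := abs_meanR_le hv hs r z
  -- the two integrands
  have hE : Continuous fun θ => (⟪v s (cylPt r θ z), e3A⟫ - meanZ v r z s) * ⟪curl (v s) (cylPt r θ z), eR θ⟫ * r :=
    (((hvc.inner continuous_const).sub continuous_const).mul (hωc.inner continuous_eR)).mul continuous_const
  have hF : Continuous fun θ => (⟪v s (cylPt r θ z), eR θ⟫ - meanR v r z s) * ⟪curl (v s) (cylPt r θ z), e3A⟫ * r :=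
    (((hvc.inner continuous_eR).sub continuous_const).mul (hωc.inner continuous_const)).mul continuous_const
  have hsplit : remainder v r z s =
      (∫ θ in (0 : ℝ)..(2 * Real.pi), (⟪v s (cylPt r θ z), e3A⟫ - meanZ v r z s) * ⟪curl (v s) (cylPt r θ z), eR θ⟫ * r) -
        ∫ θ in (0 : ℝ)..(2 * Real.pi), (⟪v s (cylPt r θ z), eR θ⟫ - meanR v r z s) * ⟪curl (v s) (cylPt r θ z), e3A⟫ * r := by
    rw [remainder, ← intervalIntegral.integral_sub (hE.intervalIntegrable _ _) (hF.intervalIntegrable _ _)]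
    congr 1
    funext θ
    ring
  rw [hsplit]
  -- the free bound on the second part
  have h2 : -(∫ θ in (0 : ℝ)..(2 * Real.pi), (⟪v s (cylPt r θ z), eR θ⟫ - meanR v r z s) * ⟪curl (v s) (cylPt r θ z), e3A⟫ * r) ≤
      2 * C / Real.sqrt (-s) * vortCirc v r z s := by
    rw [← intervalIntegral.integral_neg, vortCirc, ← intervalIntegral.integral_const_mul]
    refine intervalIntegral.integral_mono_on (by positivity) (hF.neg.intervalIntegrable _ _)
      ((continuous_const.mul ((hωc.inner continuous_const).mul continuous_const)).intervalIntegrable _ _) fun θ _ => ?_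
    have hω : 0 ≤ ⟪curl (v s) (cylPt r θ z), e3A⟫ := signE3_atd hsign s hs _
    have hvr : |⟪v s (cylPt r θ z), eR θ⟫ - meanR v r z s| ≤ 2 * C / Real.sqrt (-s) := by
      have h1 : |⟪v s (cylPt r θ z), eR θ⟫| ≤ C / Real.sqrt (-s) := (abs_inner_eR_le _ θ).trans (hv.1 s hs _)
      calc |⟪v s (cylPt r θ z), eR θ⟫ - meanR v r z s| ≤ |⟪v s (cylPt r θ z), eR θ⟫| + |meanR v r z s| := abs_sub _ _
        _ ≤ C / Real.sqrt (-s) + C / Real.sqrt (-s) := add_le_add h1 hmR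
        _ = 2 * C / Real.sqrt (-s) := by ring
    have hωr : 0 ≤ ⟪curl (v s) (cylPt r θ z), e3A⟫ * r := mul_nonneg hω hr
    calc -((⟪v s (cylPt r θ z), eR θ⟫ - meanR v r z s) * ⟪curl (v s) (cylPt r θ z), e3A⟫ * r)
        = -(⟪v s (cylPt r θ z), eR θ⟫ - meanR v r z s) * (⟪curl (v s) (cylPt r θ z), e3A⟫ * r) := by ring
      _ ≤ |⟪v s (cylPt r θ z), eR θ⟫ - meanR v r z s| * (⟪curl (v s) (cylPt r θ z), e3A⟫ * r) :=
          mul_le_mul_of_nonneg_right (neg_le_abs _) hωr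
      _ ≤ 2 * C / Real.sqrt (-s) * (⟪curl (v s) (cylPt r θ z), e3A⟫ * r) := mul_le_mul_of_nonneg_right hvr hωr
  linarith

/-- **`|E| ≤ (2C/√(−s)) ∮|ω_r| dl`**: the eddy lift is at most the class speed times the TOTAL radial vorticity on the circle. -/
theorem eddyLift_le_radAbs (hv : InDoorClass C v) {s : ℝ} (hs : s < 0) {r : ℝ} (hr : 0 ≤ r) (z : ℝ) :
    (∫ θ in (0 : ℝ)..(2 * Real.pi), (⟪v s (cylPt r θ z), e3A⟫ - meanZ v r z s) * ⟪curl (v s) (cylPt r θ z), eR θ⟫ * r) ≤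
      2 * C / Real.sqrt (-s) * ∫ θ in (0 : ℝ)..(2 * Real.pi), |⟪curl (v s) (cylPt r θ z), eR θ⟫| * r := by
  have hsq : 0 < Real.sqrt (-s) := Real.sqrt_pos.2 (neg_pos.2 hs)
  have hC : 0 ≤ C := HalfSpaceWindowDoorCirculationCarryingRigidityConeFluxSubsolution.typeI_const_nonneg hv
  have hvc := continuous_v_circle hv hs r z
  have hωc := continuous_curl_circle hv hs r z
  have hmZ := abs_meanZ_le hv hs r z
  have hE : Continuous fun θ => (⟪v s (cylPt r θ z), e3A⟫ - meanZ v r z s) * ⟪curl (v s) (cylPt r θ z), eR θ⟫ * r :=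
    (((hvc.inner continuous_const).sub continuous_const).mul (hωc.inner continuous_eR)).mul continuous_const
  have hA : Continuous fun θ => |⟪curl (v s) (cylPt r θ z), eR θ⟫| * r := (hωc.inner continuous_eR).abs.mul continuous_const
  rw [← intervalIntegral.integral_const_mul]
  refine intervalIntegral.integral_mono_on (by positivity) (hE.intervalIntegrable _ _)
    ((continuous_const.mul hA).intervalIntegrable _ _) fun θ _ => ?_
  have hvz : |⟪v s (cylPt r θ z), e3A⟫ - meanZ v r z s| ≤ 2 * C / Real.sqrt (-s) := by
    have h1 : |⟪v s (cylPt r θ z), e3A⟫| ≤ C / Real.sqrt (-s) := (abs_inner_e3_le _).trans (hv.1 s hs _)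
    calc |⟪v s (cylPt r θ z), e3A⟫ - meanZ v r z s| ≤ |⟪v s (cylPt r θ z), e3A⟫| + |meanZ v r z s| := abs_sub _ _
      _ ≤ C / Real.sqrt (-s) + C / Real.sqrt (-s) := add_le_add h1 hmZ
      _ = 2 * C / Real.sqrt (-s) := by ring
  calc (⟪v s (cylPt r θ z), e3A⟫ - meanZ v r z s) * ⟪curl (v s) (cylPt r θ z), eR θ⟫ * r
      ≤ |(⟪v s (cylPt r θ z), e3A⟫ - meanZ v r z s) * ⟪curl (v s) (cylPt r θ z), eR θ⟫ * r| := le_abs_self _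
    _ = |⟪v s (cylPt r θ z), e3A⟫ - meanZ v r z s| * (|⟪curl (v s) (cylPt r θ z), eR θ⟫| * r) := by
        rw [abs_mul, abs_mul, abs_of_nonneg hr, mul_assoc]
    _ ≤ 2 * C / Real.sqrt (-s) * (|⟪curl (v s) (cylPt r θ z), eR θ⟫| * r) :=
        mul_le_mul_of_nonneg_right hvz (by positivity)

/-! ### W6 from the eddy-LIFT bound (the residue) -/

/-- **W6 ⟸ THE EDDY-LIFT BOUND on record far circles.**  Door class (any `C`) + `⟪curl v, e₃⟫ ≥ 0`; if for some `B, R₀ ≥ 0` and some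
epoch `σ₀ < 0` the eddy lift obeys `E(r,z,t) = ∮(v_z − v̄_z)ω_r dl ≤ (B/√(−t))(∮ω₃ dl + |∮ω_r dl|)` for `t ≤ σ₀` on the record far
circles about the `e₃`-axis (`R₁ = 4(B+3C) + R₀ + 1`), then `⟪curl v, e₃⟫ ≡ 0`. -/
theorem inner_curl_e3_eq_zero_of_eddyLiftBound (hv : InDoorClass C v) (hsign : SignE3 v) {B : ℝ} (hB : 0 ≤ B)
    {R₀ : ℝ} (hR₀ : 0 ≤ R₀) {σ₀ : ℝ} (hσ₀ : σ₀ < 0)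
    (hE : ∀ t : ℝ, t ≤ σ₀ → ∀ r : ℝ, R₀ * Real.sqrt (-t) ≤ r → ∀ z : ℝ,
      (∀ s' : ℝ, s' ≤ t → ∀ z' : ℝ, circ v ((4 * (B + 2 * C + C) + R₀ + 1) * Real.sqrt (-s')) z' s' < circ v r z t) →
      (∫ θ in (0 : ℝ)..(2 * Real.pi), (⟪v t (cylPt r θ z), e3A⟫ - meanZ v r z t) * ⟪curl (v t) (cylPt r θ z), eR θ⟫ * r) ≤
        B / Real.sqrt (-t) * (vortCirc v r z t + |radVortCirc v r z t|)) :
    ∀ s < 0, ∀ y, ⟪curl (v s) y, e3⟫ = 0 := by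
  have hC : 0 ≤ C := HalfSpaceWindowDoorCirculationCarryingRigidityConeFluxSubsolution.typeI_const_nonneg hv
  have hB' : 0 ≤ B + 2 * C := by positivity
  refine inner_curl_e3_eq_zero_of_eddyBound hv hsign hB' hR₀ hσ₀ fun t ht r hr z hrec => ?_
  have ht0 : t < 0 := lt_of_le_of_lt ht hσ₀
  have hsq : 0 < Real.sqrt (-t) := Real.sqrt_pos.2 (neg_pos.2 ht0)
  have hr0 : 0 ≤ r := le_trans (by positivity) hr
  have h1 := remainder_le_eddyLift_add hv hsign ht0 hr0 z
  have h2 := hE t ht r hr z hrec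
  have hΓr : 0 ≤ vortCirc v r z t := vortCirc_nonneg v (signE3_atd hsign) ht0 hr0 _
  have habs : 0 ≤ |radVortCirc v r z t| := abs_nonneg _
  have e : (B + 2 * C) / Real.sqrt (-t) * (vortCirc v r z t + |radVortCirc v r z t|) =
      B / Real.sqrt (-t) * (vortCirc v r z t + |radVortCirc v r z t|) + 2 * C / Real.sqrt (-t) * vortCirc v r z t +
        2 * C / Real.sqrt (-t) * |radVortCirc v r z t| := by
    field_simp
    ring
  rw [e]
  have : 0 ≤ 2 * C / Real.sqrt (-t) * |radVortCirc v r z t| := by positivity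
  linarith

/-! ### Dead strata -/

/-- **STRATUM «non-cancelling radial vorticity» is dead.**  If on the far circles (`r ≥ R₀√(−t)`) of one epoch `t ≤ σ₀` the total
radial vorticity is dominated by its net amount plus the vertical vorticity, `∮|ω_r| dl ≤ K(∮ω₃ dl + |∮ω_r dl|)`, the profile is
poloidal.  Contains g9's radial circle cone (`∮|ω_r| dl ≤ K∮ω₃ dl`). -/
theorem inner_curl_e3_eq_zero_of_radial_noncancel (hv : InDoorClass C v) (hsign : SignE3 v) {K : ℝ} (hK : 0 ≤ K)
    {R₀ : ℝ} (hR₀ : 0 ≤ R₀) {σ₀ : ℝ} (hσ₀ : σ₀ < 0)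
    (hnc : ∀ t : ℝ, t ≤ σ₀ → ∀ r : ℝ, R₀ * Real.sqrt (-t) ≤ r → ∀ z : ℝ,
      (∫ θ in (0 : ℝ)..(2 * Real.pi), |⟪curl (v t) (cylPt r θ z), eR θ⟫| * r) ≤
        K * (vortCirc v r z t + |radVortCirc v r z t|)) :
    ∀ s < 0, ∀ y, ⟪curl (v s) y, e3⟫ = 0 := by
  have hC : 0 ≤ C := HalfSpaceWindowDoorCirculationCarryingRigidityConeFluxSubsolution.typeI_const_nonneg hv
  have hB : 0 ≤ 2 * C * K := by positivity
  refine inner_curl_e3_eq_zero_of_eddyLiftBound hv hsign hB hR₀ hσ₀ fun t ht r hr z _ => ?_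
  have ht0 : t < 0 := lt_of_le_of_lt ht hσ₀
  have hsq : 0 < Real.sqrt (-t) := Real.sqrt_pos.2 (neg_pos.2 ht0)
  have hr0 : 0 ≤ r := le_trans (by positivity) hr
  have h1 := eddyLift_le_radAbs hv ht0 hr0 z
  have h2 := hnc t ht r hr z
  calc (∫ θ in (0 : ℝ)..(2 * Real.pi), (⟪v t (cylPt r θ z), e3A⟫ - meanZ v r z t) * ⟪curl (v t) (cylPt r θ z), eR θ⟫ * r)
      ≤ 2 * C / Real.sqrt (-t) * ∫ θ in (0 : ℝ)..(2 * Real.pi), |⟪curl (v t) (cylPt r θ z), eR θ⟫| * r := h1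
    _ ≤ 2 * C / Real.sqrt (-t) * (K * (vortCirc v r z t + |radVortCirc v r z t|)) :=
        mul_le_mul_of_nonneg_left h2 (by positivity)
    _ = 2 * C * K / Real.sqrt (-t) * (vortCirc v r z t + |radVortCirc v r z t|) := by ring

/-- **STRATUM «one-signed radial vorticity» is dead.**  If on each far circle of one epoch the radial vorticity is either `≥ 0` all
around or `≤ 0` all around (the sign may vary with the circle), the profile is poloidal (`∮|ω_r| dl = |∮ω_r dl|`). -/
theorem inner_curl_e3_eq_zero_of_radial_oneSigned (hv : InDoorClass C v) (hsign : SignE3 v)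
    {R₀ : ℝ} (hR₀ : 0 ≤ R₀) {σ₀ : ℝ} (hσ₀ : σ₀ < 0)
    (hone : ∀ t : ℝ, t ≤ σ₀ → ∀ r : ℝ, R₀ * Real.sqrt (-t) ≤ r → ∀ z : ℝ,
      (∀ θ, 0 ≤ ⟪curl (v t) (cylPt r θ z), eR θ⟫) ∨ (∀ θ, ⟪curl (v t) (cylPt r θ z), eR θ⟫ ≤ 0)) :
    ∀ s < 0, ∀ y, ⟪curl (v s) y, e3⟫ = 0 := by
  refine inner_curl_e3_eq_zero_of_radial_noncancel hv hsign zero_le_one hR₀ hσ₀ fun t ht r hr z => ?_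
  have ht0 : t < 0 := lt_of_le_of_lt ht hσ₀
  have hr0 : 0 ≤ r := le_trans (by positivity) hr
  have hΓr : 0 ≤ vortCirc v r z t := vortCirc_nonneg v (signE3_atd hsign) ht0 hr0 _
  rw [one_mul]
  have key : (∫ θ in (0 : ℝ)..(2 * Real.pi), |⟪curl (v t) (cylPt r θ z), eR θ⟫| * r) = |radVortCirc v r z t| := by
    rcases hone t ht r hr z with hp | hn
    · have e : (fun θ => |⟪curl (v t) (cylPt r θ z), eR θ⟫| * r) = fun θ => ⟪curl (v t) (cylPt r θ z), eR θ⟫ * r := by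
        funext θ; rw [abs_of_nonneg (hp θ)]
      rw [e, radVortCirc, abs_of_nonneg]
      exact intervalIntegral.integral_nonneg (by positivity) fun θ _ => mul_nonneg (hp θ) hr0
    · have e : (fun θ => |⟪curl (v t) (cylPt r θ z), eR θ⟫| * r) = fun θ => -(⟪curl (v t) (cylPt r θ z), eR θ⟫ * r) := by
        funext θ; rw [abs_of_nonpos (hn θ)]; ring
      rw [e, intervalIntegral.integral_neg, radVortCirc, abs_of_nonpos]
      have : ∫ θ in (0 : ℝ)..(2 * Real.pi), -(⟪curl (v t) (cylPt r θ z), eR θ⟫ * r) ≥ 0 :=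
        intervalIntegral.integral_nonneg (by positivity) fun θ _ => by nlinarith [hn θ]
      rw [intervalIntegral.integral_neg] at this
      linarith
  rw [key]
  linarith

/-- **STRATUM «axisymmetric vertical velocity in the far field» is dead.**  If on each far circle of one epoch the vertical velocity is
constant around the circle (`v_z(cylPt r θ z) = v_z(cylPt r 0 z)` for all `θ`), the profile is poloidal — the eddy lift vanishes
identically, whatever the horizontal velocity and the vorticity do. -/
theorem inner_curl_e3_eq_zero_of_axisymmetric_vz (hv : InDoorClass C v) (hsign : SignE3 v)
    {R₀ : ℝ} (hR₀ : 0 ≤ R₀) {σ₀ : ℝ} (hσ₀ : σ₀ < 0)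
    (hax : ∀ t : ℝ, t ≤ σ₀ → ∀ r : ℝ, R₀ * Real.sqrt (-t) ≤ r → ∀ z : ℝ,
      ∀ θ, ⟪v t (cylPt r θ z), e3A⟫ = ⟪v t (cylPt r 0 z), e3A⟫) :
    ∀ s < 0, ∀ y, ⟪curl (v s) y, e3⟫ = 0 := by
  refine inner_curl_e3_eq_zero_of_eddyLiftBound hv hsign le_rfl hR₀ hσ₀ fun t ht r hr z _ => ?_
  have ht0 : t < 0 := lt_of_le_of_lt ht hσ₀
  have hr0 : 0 ≤ r := le_trans (by positivity) hr
  have hΓr : 0 ≤ vortCirc v r z t := vortCirc_nonneg v (signE3_atd hsign) ht0 hr0 _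
  have hmean : meanZ v r z t = ⟪v t (cylPt r 0 z), e3A⟫ := by
    rw [meanZ]
    have e : (fun θ => ⟪v t (cylPt r θ z), e3A⟫) = fun _ => ⟪v t (cylPt r 0 z), e3A⟫ := funext (hax t ht r hr z)
    rw [e, intervalIntegral.integral_const, smul_eq_mul, sub_zero, ← mul_assoc, inv_mul_cancel₀ (by positivity), one_mul]
  have e : (fun θ => (⟪v t (cylPt r θ z), e3A⟫ - meanZ v r z t) * ⟪curl (v t) (cylPt r θ z), eR θ⟫ * r) = fun _ => 0 := by
    funext θ; rw [hmean, hax t ht r hr z θ, sub_self, zero_mul, zero_mul]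
  rw [e, intervalIntegral.integral_const, smul_zero, zero_div, zero_mul]

/-! ### Enemy reading -/

/-- **ENEMY: CANCELLING RADIAL VORTICITY on record far circles.**  A circulation-carrying closed-hemisphere door-class profile has, for all
`K, R₀ ≥ 0` and every epoch `σ₀ < 0`, a time `t ≤ σ₀` and a far circle `S(r,z)`, `r ≥ R₀√(−t)`, on which
`∮|ω_r| dl > K(∮ω₃ dl + |∮ω_r dl|)` — the radial vorticity changes sign around the circle, and both its net amount and the vertical
vorticity are negligible against its total: vortex lines WEAVE in and out of every far cylinder wall. -/
theorem enemy_radial_cancelling (hv : InDoorClass C v) (hsign : SignE3 v) (hpos : ∃ σ < 0, ∃ y, 0 < ⟪curl (v σ) y, e3⟫)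
    {K : ℝ} (hK : 0 ≤ K) {R₀ : ℝ} (hR₀ : 0 ≤ R₀) {σ₀ : ℝ} (hσ₀ : σ₀ < 0) :
    ∃ t : ℝ, t ≤ σ₀ ∧ ∃ r : ℝ, R₀ * Real.sqrt (-t) ≤ r ∧ ∃ z : ℝ,
      K * (vortCirc v r z t + |radVortCirc v r z t|) < ∫ θ in (0 : ℝ)..(2 * Real.pi), |⟪curl (v t) (cylPt r θ z), eR θ⟫| * r := by
  by_contra h
  push Not at h
  obtain ⟨σ, hσ, y, hy⟩ := hpos
  have h0 := inner_curl_e3_eq_zero_of_radial_noncancel hv hsign hK hR₀ hσ₀ (fun t ht r hr z => h t ht r hr z) σ hσ y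
  exact hy.ne' h0

/-- **BY-NAME REDUCTION of W6 to the eddy-lift bound.** -/
theorem hemisphereLiouvilleE3_of_eddyLiftBound
    (H : ∀ (C : ℝ) (v : ℝ → EuclideanSpace ℝ (Fin 3) → EuclideanSpace ℝ (Fin 3)), InDoorClass C v → SignE3 v →
      ∃ B : ℝ, 0 ≤ B ∧ ∃ R₀ : ℝ, 0 ≤ R₀ ∧ ∃ σ₀ : ℝ, σ₀ < 0 ∧
        ∀ t : ℝ, t ≤ σ₀ → ∀ r : ℝ, R₀ * Real.sqrt (-t) ≤ r → ∀ z : ℝ,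
          (∀ s' : ℝ, s' ≤ t → ∀ z' : ℝ, circ v ((4 * (B + 2 * C + C) + R₀ + 1) * Real.sqrt (-s')) z' s' < circ v r z t) →
          (∫ θ in (0 : ℝ)..(2 * Real.pi), (⟪v t (cylPt r θ z), e3A⟫ - meanZ v r z t) * ⟪curl (v t) (cylPt r θ z), eR θ⟫ * r) ≤
            B / Real.sqrt (-t) * (vortCirc v r z t + |radVortCirc v r z t|)) :
    HemisphereLiouvilleE3 := by
  intro C v hrate hcont hmild hdiv hnn
  have hv : InDoorClass C v := ⟨hrate, hcont, hmild, hdiv⟩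
  obtain ⟨B, hB, R₀, hR₀, σ₀, hσ₀, hE⟩ := H C v hv hnn
  exact inner_curl_e3_eq_zero_of_eddyLiftBound hv hnn hB hR₀ hσ₀ hE

end Summit.NavierStokesRegularity.NavierStokesRegularity.Theorems.HalfSpaceWindowDoorCirculationCarryingRigidityEddyStrata

end
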